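import Literature.MathematicalPhysics.QuantumFieldTheory.Balaban1983to89.B12Eq311CurrentExpansion

/-!
# `Balaban1983to89.B12Eq311PlaquetteBounds` — [Balaban1987RG1] (3.11) p. 272 by the route [Balaban1985RegularSpaces] (1.43)–(1.54):
# file 2 of 4 — ONE-PLAQUETTE NORM BOUNDS and the bookkeeping of the plaquette adjoint `D*`

statement-level skeleton of published theorems with citation tags; proofs where landed; nothing here is a claim about the Yang–Mills mass gap

Cell `lit-balaban`, unit `lit-balaban-p07` (Phase-2 proof seat p07 gen 7); SKELETON row `B12.Eq3.10-3.12`; HOME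
`run/shared/lean/pub/lit-balaban/`.  See the header of `B12Eq311CurrentExpansion` (file 1) for the printed texts, the carriers and the
HONEST SCOPE; this file is theorems only.

THIS FILE.  §1 `D*` (`B9Eq39Adjoint.divP`): `divP_sub`, the COUNTING BOUND `norm_sub_sum_ite_le` / `norm_divP_le` (`‖(D*F)_μ(x)‖ ≤
(#directions − 1)·B` when every positively oriented directional term is `≤ B`), `divP_sub_divP` / `norm_divP_sub_divP_le` (two
transports, same plaquette function), `norm_covDstar_le`.  §2 one plaquette: `norm_comm_sub_comm_le`, **`norm_commSum_four_sub_le`**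
(`‖commSum l′ − commSum l‖ ≤ (size l + size l′)·Σ_j‖l′_j − l_j‖` — the second-order term is Lipschitz in the letters, which under
`D*` become covariant derivatives: [14] p. 85 «we use these factors to cancel η⁻¹»), `R_commSum_four`, `R_q₂`,
**`norm_R_q₂_sub_q₂_le`**, `norm_mul_holonomy_two_le`, `norm_holonomy_two_sub_one_le`, **`norm_tP_le`**
(`‖t_P‖ ≤ 2(e^s − 1)e^s(1 + r)‖P − 1‖`), **`norm_r₃_le`** (`‖r₃‖ ≤ (s³/6)e^s + (e^s − 1)e^s(1 + r)‖P − 1‖`: third order in the letters plus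
first order times the background plaquette deviation — [14] (1.44), (1.47)–(1.48)).
-/

noncomputable section

open NormedSpace Complex

namespace Literature.MathematicalPhysics.QuantumFieldTheory.Balaban1983to89.B12Eq311PlaquetteBounds

open Literature.MathematicalPhysics.QuantumFieldTheory.Balaban1983to89
open Literature.MathematicalPhysics.QuantumFieldTheory.Balaban1983to89.Beta.TransportVertices
open Literature.MathematicalPhysics.QuantumFieldTheory.Balaban1983to89.Beta.AdjointTransportJets
open Literature.MathematicalPhysics.QuantumFieldTheory.Balaban1983to89.B9Eq37Insertion
open Literature.MathematicalPhysics.QuantumFieldTheory.Balaban1983to89.B9Eq39Adjoint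
open Literature.MathematicalPhysics.QuantumFieldTheory.Balaban1983to89.B9Eq369Small Literature.MathematicalPhysics.QuantumFieldTheory.Balaban1983to89.B9Eq369Product
open Literature.MathematicalPhysics.QuantumFieldTheory.Balaban1983to89.B9Eq370Expansion
open Literature.MathematicalPhysics.QuantumFieldTheory.Balaban1983to89.B9TorusCalculus
open Literature.MathematicalPhysics.QuantumFieldTheory.Balaban1983to89.B12Eq311CurrentExpansion

/-! ## §1  Bookkeeping of the plaquette adjoint `D*` -/

section DivP

variable {𝔸 : Type*} [NormedRing 𝔸] {S : Type*} {ι : Type*} [Fintype ι] [LinearOrder ι]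
variable (T : ι → Equiv.Perm S) (V : ι → S → 𝔸ˣ)

/-- `D*(F − G) = D*F − D*G` for the plaquette adjoint (3.9). [cite: Balaban1985BackgroundPropagators, (3.9) p.392] -/
theorem divP_sub (F G : ι → ι → S → 𝔸) (μ : ι) (x : S) :
    divP T V (F - G) μ x = divP T V F μ x - divP T V G μ x := by
  simp only [divP, Pi.sub_apply, covDstar_sub]
  have h1 : (∑ ν, if ν < μ then covDstar T V ν (F ν μ) x - covDstar T V ν (G ν μ) x else 0)
      = (∑ ν, if ν < μ then covDstar T V ν (F ν μ) x else 0) - ∑ ν, if ν < μ then covDstar T V ν (G ν μ) x else 0 := by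
    rw [← Finset.sum_sub_distrib]
    refine Finset.sum_congr rfl fun ν _ => ?_
    split_ifs <;> simp
  have h2 : (∑ ν, if μ < ν then covDstar T V ν (F μ ν) x - covDstar T V ν (G μ ν) x else 0)
      = (∑ ν, if μ < ν then covDstar T V ν (F μ ν) x else 0) - ∑ ν, if μ < ν then covDstar T V ν (G μ ν) x else 0 := by
    rw [← Finset.sum_sub_distrib]
    refine Finset.sum_congr rfl fun ν _ => ?_
    split_ifs <;> simp
  rw [h1, h2]; abel

/-- THE COUNTING BOUND: a difference `Σ_{ν<μ} f_ν − Σ_{ν>μ} g_ν` of direction sums with every term bounded by `B` has norm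
`≤ (#directions − 1)·B` (the `ν = μ` slot is empty in both sums) — the shape of (3.9)'s two sums. [cite: Balaban1985BackgroundPropagators, (3.9) p.392] -/
theorem norm_sub_sum_ite_le {f g : ι → 𝔸} {B : ℝ} (μ : ι) (h₁ : ∀ ν, ν < μ → ‖f ν‖ ≤ B) (h₂ : ∀ ν, μ < ν → ‖g ν‖ ≤ B) :
    ‖(∑ ν, if ν < μ then f ν else 0) - ∑ ν, if μ < ν then g ν else 0‖ ≤ (Fintype.card ι - 1) * B := by
  have hB : ∀ ν, ‖(if ν < μ then f ν else 0)‖ + ‖(if μ < ν then g ν else 0)‖ ≤ if ν ≠ μ then B else 0 := by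
    intro ν
    rcases lt_trichotomy ν μ with hlt | rfl | hgt
    · simp only [hlt, if_true, lt_asymm hlt, if_false, norm_zero, add_zero, hlt.ne, ne_eq, not_false_eq_true]
      exact h₁ ν hlt
    · simp
    · simp only [hgt, if_true, lt_asymm hgt, if_false, norm_zero, zero_add, hgt.ne', ne_eq, not_false_eq_true]
      exact h₂ ν hgt
  haveI : Nonempty ι := ⟨μ⟩
  have hcount : (∑ ν, if ν ≠ μ then B else 0) = (Fintype.card ι - 1) * B := by
    rw [Finset.sum_ite, Finset.sum_const_zero, add_zero, Finset.sum_const, nsmul_eq_mul,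
      Finset.filter_ne', Finset.card_erase_of_mem (Finset.mem_univ μ), Finset.card_univ,
      Nat.cast_sub Fintype.card_pos, Nat.cast_one]
  calc ‖(∑ ν, if ν < μ then f ν else 0) - ∑ ν, if μ < ν then g ν else 0‖
      ≤ ‖∑ ν, if ν < μ then f ν else 0‖ + ‖∑ ν, if μ < ν then g ν else 0‖ := norm_sub_le _ _
    _ ≤ (∑ ν, ‖if ν < μ then f ν else 0‖) + ∑ ν, ‖if μ < ν then g ν else 0‖ :=
        add_le_add (norm_sum_le _ _) (norm_sum_le _ _)
    _ = ∑ ν, (‖if ν < μ then f ν else 0‖ + ‖if μ < ν then g ν else 0‖) := by rw [Finset.sum_add_distrib]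
    _ ≤ ∑ ν, if ν ≠ μ then B else 0 := Finset.sum_le_sum fun ν _ => hB ν
    _ = (Fintype.card ι - 1) * B := hcount

/-- `‖(D*F)_μ(x)‖ ≤ (#directions − 1)·B` if every directional term (over positively oriented plaquettes `p_{νμ}`, `ν < μ`, and
`p_{μν}`, `μ < ν`) is bounded by `B`. [cite: Balaban1985BackgroundPropagators, (3.9) p.392] -/
theorem norm_divP_le (F : ι → ι → S → 𝔸) (μ : ι) (x : S) {B : ℝ}
    (h₁ : ∀ ν, ν < μ → ‖covDstar T V ν (F ν μ) x‖ ≤ B) (h₂ : ∀ ν, μ < ν → ‖covDstar T V ν (F μ ν) x‖ ≤ B) :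
    ‖divP T V F μ x‖ ≤ (Fintype.card ι - 1) * B :=
  norm_sub_sum_ite_le μ h₁ h₂

/-- The difference of the plaquette adjoints (3.9) of TWO configurations on the same plaquette function, direction by direction.
[cite: Balaban1985BackgroundPropagators, (3.9) p.392] -/
theorem divP_sub_divP (V' : ι → S → 𝔸ˣ) (F : ι → ι → S → 𝔸) (μ : ι) (x : S) :
    divP T V' F μ x - divP T V F μ x
      = (∑ ν, if ν < μ then (covDstar T V' ν (F ν μ) x - covDstar T V ν (F ν μ) x) else 0)
        - ∑ ν, if μ < ν then (covDstar T V' ν (F μ ν) x - covDstar T V ν (F μ ν) x) else 0 := by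
  simp only [divP]
  have h1 : (∑ ν, if ν < μ then covDstar T V' ν (F ν μ) x - covDstar T V ν (F ν μ) x else 0)
      = (∑ ν, if ν < μ then covDstar T V' ν (F ν μ) x else 0) - ∑ ν, if ν < μ then covDstar T V ν (F ν μ) x else 0 := by
    rw [← Finset.sum_sub_distrib]
    refine Finset.sum_congr rfl fun ν _ => ?_
    split_ifs <;> simp
  have h2 : (∑ ν, if μ < ν then covDstar T V' ν (F μ ν) x - covDstar T V ν (F μ ν) x else 0)
      = (∑ ν, if μ < ν then covDstar T V' ν (F μ ν) x else 0) - ∑ ν, if μ < ν then covDstar T V ν (F μ ν) x else 0 := by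
    rw [← Finset.sum_sub_distrib]
    refine Finset.sum_congr rfl fun ν _ => ?_
    split_ifs <;> simp
  rw [h1, h2]; abel

/-- … hence `‖(D*_{V′}F)_μ(x) − (D*_V F)_μ(x)‖ ≤ (#directions − 1)·B` if every directional difference is bounded by `B`.
[cite: Balaban1985BackgroundPropagators, (3.9) p.392] -/
theorem norm_divP_sub_divP_le (V' : ι → S → 𝔸ˣ) (F : ι → ι → S → 𝔸) (μ : ι) (x : S) {B : ℝ}
    (h₁ : ∀ ν, ν < μ → ‖covDstar T V' ν (F ν μ) x - covDstar T V ν (F ν μ) x‖ ≤ B)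
    (h₂ : ∀ ν, μ < ν → ‖covDstar T V' ν (F μ ν) x - covDstar T V ν (F μ ν) x‖ ≤ B) :
    ‖divP T V' F μ x - divP T V F μ x‖ ≤ (Fintype.card ι - 1) * B := by
  rw [divP_sub_divP]; exact norm_sub_sum_ite_le μ h₁ h₂

omit [Fintype ι] [LinearOrder ι] in
/-- `‖(D*_ν H)(x)‖ ≤ ρ²‖H(x − e_ν)‖ + ‖H(x)‖` for a background with `‖V(b)^{±1}‖ ≤ ρ` ((3.8)'s `D*_ν`). [cite: Balaban1985BackgroundPropagators, (3.8) p.392] -/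
theorem norm_covDstar_le {ρ : ℝ} (hV : ∀ μ x, ‖(V μ x : 𝔸)‖ ≤ ρ ∧ ‖(((V μ x)⁻¹ : 𝔸ˣ) : 𝔸)‖ ≤ ρ)
    (ν : ι) (H : S → 𝔸) (x : S) :
    ‖covDstar T V ν H x‖ ≤ ρ ^ 2 * ‖H ((T ν).symm x)‖ + ‖H x‖ := by
  unfold covDstar
  exact (norm_sub_le _ _).trans (add_le_add (norm_R_inv_le_rho (hV _ _).1 (hV _ _).2 _) le_rfl)

end DivP

/-! ## §2  Norm bounds at one plaquette -/

section PlaquetteBounds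

variable {𝔸 : Type*} [NormedRing 𝔸] [NormedAlgebra ℂ 𝔸] [CompleteSpace 𝔸]

/-- `‖(2i)⁻¹‖ = ½`. [folklore] -/
private theorem norm_inv_two_mul_I : ‖(2 * I : ℂ)⁻¹‖ = 1 / 2 := by
  rw [norm_inv, norm_mul, Complex.norm_two, Complex.norm_I, mul_one, one_div]

omit [NormedAlgebra ℂ 𝔸] [CompleteSpace 𝔸] in
/-- One commutator pair: `‖[x′, y′] − [x, y]‖ ≤ ‖x′ − x‖(‖y′‖ + ‖y‖) + ‖y′ − y‖(‖x‖ + ‖x′‖)`. [folklore] -/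
private theorem norm_comm_sub_comm_le (x y x' y' : 𝔸) :
    ‖(x' * y' - y' * x') - (x * y - y * x)‖ ≤ ‖x' - x‖ * (‖y'‖ + ‖y‖) + ‖y' - y‖ * (‖x‖ + ‖x'‖) := by
  have h : (x' * y' - y' * x') - (x * y - y * x) = (x' - x) * y' + x * (y' - y) - ((y' - y) * x' + y * (x' - x)) := by
    noncomm_ring
  rw [h]
  calc ‖(x' - x) * y' + x * (y' - y) - ((y' - y) * x' + y * (x' - x))‖
      ≤ (‖x' - x‖ * ‖y'‖ + ‖x‖ * ‖y' - y‖) + (‖y' - y‖ * ‖x'‖ + ‖y‖ * ‖x' - x‖) :=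
        norm_sub_le_of_le (norm_add_le_of_le (norm_mul_le _ _) (norm_mul_le _ _))
          (norm_add_le_of_le (norm_mul_le _ _) (norm_mul_le _ _))
    _ = ‖x' - x‖ * (‖y'‖ + ‖y‖) + ‖y' - y‖ * (‖x‖ + ‖x'‖) := by ring

omit [NormedAlgebra ℂ 𝔸] [CompleteSpace 𝔸] in
/-- **LIPSCHITZ BOUND FOR THE COMMUTATOR SUM OF FOUR LETTERS**: `‖commSum l′ − commSum l‖ ≤ (size l + size l′)·Σ_j‖l′_j − l_j‖` — the
second-order term is controlled by the DIFFERENCES of the letters (under `D*`, by covariant derivatives of `A`: [14] (1.52), the covariant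
derivative of a commutator). [cite: Balaban1985RegularSpaces, (1.52) p.85] -/
theorem norm_commSum_four_sub_le (x₁ x₂ x₃ x₄ y₁ y₂ y₃ y₄ : 𝔸) :
    ‖commSum [y₁, y₂, y₃, y₄] - commSum [x₁, x₂, x₃, x₄]‖
      ≤ (size [x₁, x₂, x₃, x₄] + size [y₁, y₂, y₃, y₄])
        * (‖y₁ - x₁‖ + ‖y₂ - x₂‖ + ‖y₃ - x₃‖ + ‖y₄ - x₄‖) := by
  rw [commSum_four, commSum_four]
  simp only [size_cons, size_nil, add_zero]
  have h12 := norm_comm_sub_comm_le x₁ x₂ y₁ y₂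
  have h13 := norm_comm_sub_comm_le x₁ x₃ y₁ y₃
  have h14 := norm_comm_sub_comm_le x₁ x₄ y₁ y₄
  have h23 := norm_comm_sub_comm_le x₂ x₃ y₂ y₃
  have h24 := norm_comm_sub_comm_le x₂ x₄ y₂ y₄
  have h34 := norm_comm_sub_comm_le x₃ x₄ y₃ y₄
  have e : (y₁ * y₂ - y₂ * y₁) + (y₁ * y₃ - y₃ * y₁) + (y₁ * y₄ - y₄ * y₁) + (y₂ * y₃ - y₃ * y₂) + (y₂ * y₄ - y₄ * y₂)
      + (y₃ * y₄ - y₄ * y₃)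
      - ((x₁ * x₂ - x₂ * x₁) + (x₁ * x₃ - x₃ * x₁) + (x₁ * x₄ - x₄ * x₁) + (x₂ * x₃ - x₃ * x₂) + (x₂ * x₄ - x₄ * x₂)
        + (x₃ * x₄ - x₄ * x₃))
      = ((y₁ * y₂ - y₂ * y₁) - (x₁ * x₂ - x₂ * x₁)) + ((y₁ * y₃ - y₃ * y₁) - (x₁ * x₃ - x₃ * x₁))
        + ((y₁ * y₄ - y₄ * y₁) - (x₁ * x₄ - x₄ * x₁)) + ((y₂ * y₃ - y₃ * y₂) - (x₂ * x₃ - x₃ * x₂))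
        + ((y₂ * y₄ - y₄ * y₂) - (x₂ * x₄ - x₄ * x₂)) + ((y₃ * y₄ - y₄ * y₃) - (x₃ * x₄ - x₄ * x₃)) := by abel
  rw [e]
  refine (norm_add_le_of_le (norm_add_le_of_le (norm_add_le_of_le (norm_add_le_of_le (norm_add_le_of_le h12 h13) h14)
    h23) h24) h34).trans ?_
  have hx₁ := norm_nonneg x₁; have hx₂ := norm_nonneg x₂; have hx₃ := norm_nonneg x₃; have hx₄ := norm_nonneg x₄
  have hy₁ := norm_nonneg y₁; have hy₂ := norm_nonneg y₂; have hy₃ := norm_nonneg y₃; have hy₄ := norm_nonneg y₄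
  have hd₁ := norm_nonneg (y₁ - x₁); have hd₂ := norm_nonneg (y₂ - x₂); have hd₃ := norm_nonneg (y₃ - x₃)
  have hd₄ := norm_nonneg (y₄ - x₄)
  nlinarith [mul_nonneg hd₁ (add_nonneg hx₁ hy₁), mul_nonneg hd₂ (add_nonneg hx₂ hy₂), mul_nonneg hd₃ (add_nonneg hx₃ hy₃),
    mul_nonneg hd₄ (add_nonneg hx₄ hy₄)]

omit [NormedAlgebra ℂ 𝔸] [CompleteSpace 𝔸] in
/-- Transport is an algebra automorphism: `R(W)·commSum l = commSum (R(W)l)`. [folklore] -/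
private theorem R_commSum_four (W : 𝔸ˣ) (x₁ x₂ x₃ x₄ : 𝔸) :
    R W (commSum [x₁, x₂, x₃, x₄]) = commSum [R W x₁, R W x₂, R W x₃, R W x₄] := by
  simp only [commSum_four, R_add, R_sub, ← R_mul_R]

omit [CompleteSpace 𝔸] in
/-- … hence `R(W)q₂(l) = q₂(R(W)l)`. [folklore] -/
private theorem R_q₂ (W : 𝔸ˣ) (x₁ x₂ x₃ x₄ : 𝔸) : R W (q₂ x₁ x₂ x₃ x₄) = q₂ (R W x₁) (R W x₂) (R W x₃) (R W x₄) := by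
  rw [q₂, q₂, R_smul, R_commSum_four]

omit [CompleteSpace 𝔸] in
/-- **THE SECOND-ORDER TERM UNDER A COVARIANT DIFFERENCE**: `‖R(W)q₂(l) − q₂(l′)‖ ≤ ½(size l′ + size R(W)l)·Σ_j‖R(W)l_j − l′_j‖`
([14] (1.51)–(1.53): `D*` of the second-order polynomial is first order in the derivatives). [cite: Balaban1985RegularSpaces, (1.53) p.85] -/
theorem norm_R_q₂_sub_q₂_le (W : 𝔸ˣ) (x₁ x₂ x₃ x₄ y₁ y₂ y₃ y₄ : 𝔸) :
    ‖R W (q₂ x₁ x₂ x₃ x₄) - q₂ y₁ y₂ y₃ y₄‖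
      ≤ 1 / 2 * ((size [y₁, y₂, y₃, y₄] + size [R W x₁, R W x₂, R W x₃, R W x₄])
        * (‖R W x₁ - y₁‖ + ‖R W x₂ - y₂‖ + ‖R W x₃ - y₃‖ + ‖R W x₄ - y₄‖)) := by
  rw [R_q₂, q₂, q₂, ← smul_sub, norm_smul, norm_inv_two_mul_I]
  exact mul_le_mul_of_nonneg_left (norm_commSum_four_sub_le _ _ _ _ _ _ _ _) (by norm_num)

/-- `‖e^{l}e^{l′}‖ ≤ e^{‖l‖+‖l′‖}`-type bound for a right factor: `‖X·holonomy [l, l′]‖ ≤ ‖X‖e^{‖l‖ + ‖l′‖}`. [folklore] -/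
private theorem norm_mul_holonomy_two_le (X l l' : 𝔸) : ‖X * holonomy [l, l']‖ ≤ ‖X‖ * Real.exp (‖l‖ + ‖l'‖) := by
  simp only [holonomy_cons, holonomy_nil, mul_one]
  rw [← mul_assoc, Real.exp_add, ← mul_assoc]
  exact (B12Membership314.norm_mul_exp_le _ _).trans
    (mul_le_mul_of_nonneg_right (B12Membership314.norm_mul_exp_le _ _) (Real.exp_pos _).le)

/-- `‖holonomy [l, l′] − 1‖ ≤ e^{‖l‖+‖l′‖} − 1`. [folklore] -/
private theorem norm_holonomy_two_sub_one_le (l l' : 𝔸) : ‖holonomy [l, l'] - 1‖ ≤ Real.exp (‖l‖ + ‖l'‖) - 1 := by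
  have h := norm_holonomy_sub_one_le ℂ [l, l']
  simp only [size_cons, size_nil, add_zero, expTail_one] at h
  exact h

/-- **THE DRESSING TERM**: `‖t_P‖ ≤ 2(e^{s} − 1)e^{s}(1 + r)‖P − 1‖` for `size l ≤ s` and `‖P⁻¹‖ ≤ r` — [14] p. 84 «The first two terms on
the right-hand side can be bounded by 4α₂α₀(Lʲη)⁻³η³». [cite: Balaban1985RegularSpaces, (1.44) p.84] -/
theorem norm_tP_le (P : 𝔸ˣ) (l₁ l₂ l₃ l₄ : 𝔸) {s r : ℝ} (hs : size [l₁, l₂, l₃, l₄] ≤ s)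
    (hr : ‖((P⁻¹ : 𝔸ˣ) : 𝔸)‖ ≤ r) :
    ‖tP P l₁ l₂ l₃ l₄‖ ≤ 2 * (Real.exp s - 1) * Real.exp s * (1 + r) * ‖(P : 𝔸) - 1‖ := by
  simp only [size_cons, size_nil, add_zero] at hs
  have hr0 : 0 ≤ r := (norm_nonneg _).trans hr
  have hε := norm_nonneg ((P : 𝔸) - 1)
  have hPi : ‖((P⁻¹ : 𝔸ˣ) : 𝔸) - 1‖ ≤ r * ‖(P : 𝔸) - 1‖ := norm_inv_sub_one_le hr
  have h12 : Real.exp (‖l₁‖ + ‖l₂‖) ≤ Real.exp s := Real.exp_le_exp.mpr (by linarith [norm_nonneg l₃, norm_nonneg l₄])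
  have h34 : Real.exp (‖l₃‖ + ‖l₄‖) ≤ Real.exp s := Real.exp_le_exp.mpr (by linarith [norm_nonneg l₁, norm_nonneg l₂])
  have h43 : Real.exp (‖-l₄‖ + ‖-l₃‖) ≤ Real.exp s := by
    rw [norm_neg, norm_neg]; exact Real.exp_le_exp.mpr (by linarith [norm_nonneg l₁, norm_nonneg l₂])
  have h21 : Real.exp (‖-l₂‖ + ‖-l₁‖) ≤ Real.exp s := by
    rw [norm_neg, norm_neg]; exact Real.exp_le_exp.mpr (by linarith [norm_nonneg l₃, norm_nonneg l₄])
  have hs1 : 1 ≤ Real.exp s := Real.one_le_exp (by linarith [norm_nonneg l₁, norm_nonneg l₂, norm_nonneg l₃, norm_nonneg l₄])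
  -- the four products
  have t1 : ‖(holonomy [l₁, l₂] - 1) * ((P : 𝔸) - 1) * holonomy [l₃, l₄]‖
      ≤ (Real.exp s - 1) * ‖(P : 𝔸) - 1‖ * Real.exp s := by
    refine (norm_mul_holonomy_two_le _ _ _).trans ?_
    refine mul_le_mul ((norm_mul_le _ _).trans (mul_le_mul_of_nonneg_right
      ((norm_holonomy_two_sub_one_le _ _).trans (by linarith)) hε)) h34 (Real.exp_pos _).le ?_
    exact mul_nonneg (by linarith) hε
  have t2 : ‖((P : 𝔸) - 1) * (holonomy [l₃, l₄] - 1)‖ ≤ ‖(P : 𝔸) - 1‖ * (Real.exp s - 1) :=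
    (norm_mul_le _ _).trans (mul_le_mul_of_nonneg_left ((norm_holonomy_two_sub_one_le _ _).trans (by linarith)) hε)
  have t3 : ‖(holonomy [-l₄, -l₃] - 1) * (((P⁻¹ : 𝔸ˣ) : 𝔸) - 1) * holonomy [-l₂, -l₁]‖
      ≤ (Real.exp s - 1) * (r * ‖(P : 𝔸) - 1‖) * Real.exp s := by
    refine (norm_mul_holonomy_two_le _ _ _).trans ?_
    refine mul_le_mul ((norm_mul_le _ _).trans (mul_le_mul ((norm_holonomy_two_sub_one_le _ _).trans (by linarith)) hPi
      (norm_nonneg _) (by linarith))) h21 (Real.exp_pos _).le ?_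
    exact mul_nonneg (by linarith) (mul_nonneg hr0 hε)
  have t4 : ‖(((P⁻¹ : 𝔸ˣ) : 𝔸) - 1) * (holonomy [-l₂, -l₁] - 1)‖ ≤ (r * ‖(P : 𝔸) - 1‖) * (Real.exp s - 1) :=
    (norm_mul_le _ _).trans (mul_le_mul hPi ((norm_holonomy_two_sub_one_le _ _).trans (by linarith)) (norm_nonneg _)
      (mul_nonneg hr0 hε))
  rw [tP]
  refine (norm_sub_le_of_le (norm_add_le_of_le t1 t2) (norm_add_le_of_le t3 t4)).trans ?_
  have hE : 0 ≤ Real.exp s - 1 := by linarith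
  nlinarith [mul_nonneg hE hε, mul_nonneg (mul_nonneg hE hε) hr0, Real.exp_pos s,
    mul_nonneg (mul_nonneg hE hε) (by linarith : (0:ℝ) ≤ Real.exp s - 1),
    mul_nonneg (mul_nonneg (mul_nonneg hE hε) hr0) (by linarith : (0:ℝ) ≤ Real.exp s - 1)]

/-- **THE REMAINDER `r₃`**: `‖r₃‖ ≤ (s³/6)e^{s} + (e^{s} − 1)e^{s}(1 + r)‖P − 1‖` for `size l ≤ s`, `‖P⁻¹‖ ≤ r` — third order in the
letters plus first order times the background plaquette deviation ([14] (1.47)–(1.48): «a remainder is O₁(4³/3!·…)»).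
[cite: Balaban1985RegularSpaces, (1.48) p.84] -/
theorem norm_r₃_le (P : 𝔸ˣ) (l₁ l₂ l₃ l₄ : 𝔸) {s r : ℝ} (hs : size [l₁, l₂, l₃, l₄] ≤ s)
    (hr : ‖((P⁻¹ : 𝔸ˣ) : 𝔸)‖ ≤ r) :
    ‖r₃ P l₁ l₂ l₃ l₄‖ ≤ s ^ 3 / 6 * Real.exp s + (Real.exp s - 1) * Real.exp s * (1 + r) * ‖(P : 𝔸) - 1‖ := by
  have hsz : 0 ≤ size [l₁, l₂, l₃, l₄] := size_nonneg _
  have hs0 : 0 ≤ s := hsz.trans hs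
  have hs3 : 0 ≤ s ^ 3 / 6 := div_nonneg (pow_nonneg hs0 3) (by norm_num)
  have hrem : ‖rem [l₁, l₂, l₃, l₄]‖ ≤ s ^ 3 / 6 * Real.exp s :=
    (norm_rem_le_cube _).trans (mul_le_mul (by gcongr) (Real.exp_le_exp.mpr hs) (Real.exp_pos _).le hs3)
  have hrem' : ‖rem (invPath [l₁, l₂, l₃, l₄])‖ ≤ s ^ 3 / 6 * Real.exp s :=
    ((norm_rem_invPath_le_expTail _).trans (expTail_three_le hsz)).trans
      (mul_le_mul (by gcongr) (Real.exp_le_exp.mpr hs) (Real.exp_pos _).le hs3)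
  have ht := norm_tP_le P l₁ l₂ l₃ l₄ hs hr
  rw [r₃, norm_smul, norm_inv_two_mul_I]
  have h3 : ‖rem [l₁, l₂, l₃, l₄] - rem (invPath [l₁, l₂, l₃, l₄]) + tP P l₁ l₂ l₃ l₄‖
      ≤ s ^ 3 / 6 * Real.exp s + s ^ 3 / 6 * Real.exp s + 2 * (Real.exp s - 1) * Real.exp s * (1 + r) * ‖(P : 𝔸) - 1‖ :=
    norm_add_le_of_le (norm_sub_le_of_le hrem hrem') ht
  linarith

end PlaquetteBounds

end Literature.MathematicalPhysics.QuantumFieldTheory.Balaban1983to89.B12Eq311PlaquetteBounds
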